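import Mathlib
import Literature.Analysis.Quadrature.TMSNetsPropagation

/-!
# `(t, m, s)`-nets and (ordered) orthogonal arrays

[primary: DickPillichshammer2010, §6.2]

J. Dick and F. Pillichshammer, *Digital Nets and Sequences. Discrepancy Theory and Quasi-Monte
Carlo Integration*, Cambridge University Press, 2010 — Chapter 6 "Connections to other discrete
objects", §6.2 "Nets and (ordered) orthogonal arrays" (pp. 242–245 of the printed book):
Definition 6.10 (orthogonal arrays `OA(M, s, b, k)` of index `λ`), the remark `M = λ bᵏ`,
Theorem 6.12 (Niederreiter: `(t, t+2, s)`-nets in base `b` ⟺ orthogonal arrays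
`OA(b^{t+2}, s, b, 2)` of index `bᵗ`), Definition 6.13 (ordered orthogonal arrays
`OOA(M, s, b, T, k)` of index `λ`, Mullen–Schmid / Lawrence), the remarks `M = λ bᵏ` and
"an `OOA(M, s, b, 1, k)` is an `OA(M, s, b, k)`", Theorem 6.15 (`(t, t+k, s)`-nets in base `b` ⟺
ordered orthogonal arrays `OOA(b^{t+k}, s, b, k-1, k)` of index `bᵗ`, with the proof printed
there), and the two printed corollaries Exercise 6.11 (an `OA(b^{t+k}, s(k-1), b, k)` of index `bᵗ`
gives a `(t, t+k, s)`-net; Mullen–Schmid) and Exercise 6.12 (a `(t, t+k, s)`-net, `s ≥ k`, gives an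
`OA(b^{t+k}, s, b, k)` of index `bᵗ`; Mullen–Schmid).

## Formalisation conventions

* An `M × s` matrix over `{0, …, b-1}` is a map `A : κ → ι → Fin b` (rows indexed by a finite type
  `κ` with `|κ| = M`, columns — "constraints" — by a finite type `ι` with `|ι| = s`).
  `IsOrthogonalArray b k lam A` (Definition 6.10) says: for every set `S` of `k` columns and every
  prescription `c` of symbols, exactly `lam` rows agree with `c` on `S` (equivalently: every
  `1 × k` row occurs in the `M × k` submatrix with frequency `lam`).  The standing size
  conventions `b ≥ 2`, `s ≥ k ≥ 1` of the book are not part of the predicate; `M = λ bᵏ` is the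
  theorem `IsOrthogonalArray.card_eq` (under `k ≤ s`, which makes the condition non-vacuous).
* An `M × sT` matrix with column labels `(i, j)`, `1 ≤ j ≤ T`, is a map
  `A : κ → ι → Fin T → Fin b` (`A n i j` = the entry in row `n`, column `(i, j+1)`; Lean's `j` is
  `0`-based).  `IsOrderedOrthogonalArray b k lam A` (Definition 6.13): for all heights
  `0 ≤ dᵢ ≤ T` with `Σᵢ dᵢ = k` and every prescription `c`, exactly `lam` rows agree with `c` on the
  first `dᵢ` columns of block `i`, for every `i`.  Again `M = λ bᵏ` is a theorem
  (`IsOrderedOrthogonalArray.card_eq`, under `k ≤ sT`).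
* `(t, m, s)`-nets in base `b` are the tree's `IsTMSNet b t m P` (geometric definition,
  [cite: DickPillichshammer2010, Def. 4.7]); the digit expansions are Mathlib's `Real.digits`
  (digit `r ≥ 1` of the book is index `r - 1`), and the bridge "elementary interval = digit
  cylinder" is the tree's `isTMSNet_iff_isDigitNetPi`.
* The proof of Theorem 6.15 is organised through the (equivalent, slightly redundant) ordered
  orthogonal array of heights `k` formed by the first `k` digits: a `(t, t+k, s)`-net gives an
  `OOA(b^{t+k}, s, b, T, k)` of index `bᵗ` for EVERY `T` by truncating digit expansions
  (`IsTMSNet.isOrderedOrthogonalArray_digits`); an `OOA(b^{t+k}, s, b, k, k)` of index `bᵗ` gives a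
  net by reading its rows as digit strings (`IsOrderedOrthogonalArray.isTMSNet_ofDigitString`);
  and the book's trick `x_{n,i} = Σ_{r<k} a^{(i)}_{n,r} b^{-r} + a^{(h(i))}_{n,1} b^{-k}`,
  `h(i) ≠ i`, is the purely combinatorial statement that appending to block `i` the first column
  of block `h(i)` turns an `OOA(M, s, b, k-1, k)` into an `OOA(M, s, b, k, k)`
  (`IsOrderedOrthogonalArray.snocColumn`, whose proof is the case distinction of the book).
* Theorem 6.15 is stated with heights `T = k - 1 ≥ 1` as
  `exists_isTMSNet_iff_exists_isOrderedOrthogonalArray` (parameter `T`, nets `(t, t+T+1, s)`)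
  and verbatim with `k ≥ 2` and `Fin (k - 1)` as `exists_isTMSNet_iff_exists_isOrderedOrthogonalArray'`.
  The hypothesis `s ≥ 2` of the book is needed (for `s = 1` there is no admissible height vector
  for an `OOA(·, 1, b, k-1, k)`, so the array condition is vacuous while nets are not).
  The base is any `b ≥ 1` (`[NeZero b]`; for `b = 1` both sides say `|κ| = 1`).
* Examples 6.11 and 6.14 (explicit small arrays) and the MINT tables are not formalised.
-/

namespace Literature.Analysis.Quadrature

open Finset

variable {b : ℕ} {ι κ : Type*}

/-! ### Orthogonal arrays and ordered orthogonal arrays -/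

section Arrays

variable [Fintype ι] [Fintype κ]

variable (b) in
/-- **Orthogonal array** `OA(M, s, b, k)` of index `lam` [cite: DickPillichshammer2010, Def. 6.10]:
an `M × s` matrix `A` (rows `κ`, `|κ| = M`; columns `ι`, `|ι| = s`) with entries in
`{0, …, b-1}` such that any `M × k` submatrix (any set `S` of `k` columns) contains every
`1 × k` row with the same frequency `lam` — i.e. for every prescription `c` of symbols exactly
`lam` rows agree with `c` on `S`. -/
def IsOrthogonalArray (k lam : ℕ) (A : κ → ι → Fin b) : Prop :=
  ∀ S : Finset ι, S.card = k → ∀ c : ι → Fin b,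
    (univ.filter fun n => ∀ i ∈ S, A n i = c i).card = lam

variable (b) in
/-- **Ordered orthogonal array** `OOA(M, s, b, T, k)` of index `lam`
[cite: DickPillichshammer2010, Def. 6.13] (Mullen–Schmid; Lawrence; Schmid): an `M × sT` matrix
`A = (A_1 | ⋯ | A_s)` of `M × T` blocks `A_i = (a^{(i)}_{n,r})` with entries in `{0, …, b-1}`
(here `A n i j = a^{(i)}_{n,j+1}`) such that for all integers `0 ≤ d_i ≤ T` with `Σ_i d_i = k`
the `M × k` matrix formed by the first `d_1` columns of `A_1`, …, the first `d_s` columns of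
`A_s` contains every `k`-tuple over `{0, …, b-1}` with the same frequency `lam` — i.e. for every
prescription `c` exactly `lam` rows `n` have `A n i j = c i j` for all `i` and all `j < d_i`. -/
def IsOrderedOrthogonalArray {T : ℕ} (k lam : ℕ) (A : κ → ι → Fin T → Fin b) : Prop :=
  ∀ d : ι → ℕ, (∀ i, d i ≤ T) → ∑ i, d i = k → ∀ c : ι → Fin T → Fin b,
    (univ.filter fun n => ∀ i (j : Fin T), (j : ℕ) < d i → A n i j = c i j).card = lam

/-- **`M = λ bᵏ` for an orthogonal array** [cite: DickPillichshammer2010, Def. 6.10] ("It follows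
from the definition that we always have `M = λ bᵏ`"; here under the standing assumption `k ≤ s`,
which provides a set of `k` columns): the rows are partitioned according to their entries on `k`
fixed columns, `bᵏ` classes of `lam` rows each. -/
theorem IsOrthogonalArray.card_eq [NeZero b] {k lam : ℕ} {A : κ → ι → Fin b}
    (hA : IsOrthogonalArray b k lam A) (hk : k ≤ Fintype.card ι) :
    Fintype.card κ = lam * b ^ k := by
  classical
  obtain ⟨S, -, hS⟩ := Finset.exists_subset_card_eq (s := (univ : Finset ι)) (by simpa using hk)
  let f : κ → (S → Fin b) := fun n i => A n i
  have hfib : ∀ g : S → Fin b, (univ.filter fun n => f n = g).card = lam := by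
    intro g
    let c : ι → Fin b := fun i => if h : i ∈ S then g ⟨i, h⟩ else 0
    rw [← hA S hS c]
    congr 1
    ext n
    simp only [mem_filter, mem_univ, true_and]
    constructor
    · rintro hg i hi
      have := congr_fun hg ⟨i, hi⟩
      simp only [f, c, dif_pos hi] at this ⊢
      exact this
    · intro hc
      funext i
      have := hc i i.2
      simp only [f, c, dif_pos i.2] at this ⊢
      exact this
  rw [← card_univ, card_eq_sum_card_fiberwise (f := f) (t := univ) fun n _ => mem_univ _,
    sum_congr rfl fun g _ => hfib g, sum_const, card_univ, smul_eq_mul, Fintype.card_fun,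
    Fintype.card_coe, hS, Fintype.card_fin, mul_comm]

/-- Admissible height vectors exist exactly when `k ≤ sT`: for `k ≤ sT` there are integers
`0 ≤ d_i ≤ T` with `Σ_i d_i = k`. [folklore] -/
private theorem exists_heights_of_le {T k : ℕ} (hk : k ≤ Fintype.card ι * T) :
    ∃ d : ι → ℕ, (∀ i, d i ≤ T) ∧ ∑ i, d i = k := by
  classical
  -- the `Fin s` case, by induction on `s`
  have key : ∀ s k : ℕ, k ≤ s * T → ∃ d : Fin s → ℕ, (∀ i, d i ≤ T) ∧ ∑ i, d i = k := by
    intro s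
    induction s with
    | zero =>
      intro k hk
      refine ⟨fun _ => 0, fun _ => Nat.zero_le _, ?_⟩
      simp only [zero_mul, nonpos_iff_eq_zero] at hk
      simp [hk]
    | succ s ih =>
      intro k hk
      by_cases hkT : k ≤ T
      · refine ⟨Fin.cons k fun _ => 0, ?_, ?_⟩
        · refine Fin.cases ?_ (fun i => ?_)
          · simpa using hkT
          · simp
        · simp [Fin.sum_univ_succ]
      · obtain ⟨d, hd, hsum⟩ := ih (k - T) (by
          have : k ≤ s * T + T := by simpa [Nat.succ_mul] using hk
          omega)
        refine ⟨Fin.cons T d, ?_, ?_⟩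
        · refine Fin.cases ?_ (fun i => ?_)
          · simp
          · simpa using hd i
        · rw [Fin.sum_univ_succ]
          simp only [Fin.cons_zero, Fin.cons_succ, hsum]
          omega
  obtain ⟨d, hd, hsum⟩ := key (Fintype.card ι) k hk
  refine ⟨fun i => d (Fintype.equivFin ι i), fun i => hd _, ?_⟩
  rw [← hsum]
  exact Equiv.sum_comp (Fintype.equivFin ι) d

/-- **`M = λ bᵏ` for an ordered orthogonal array** [cite: DickPillichshammer2010, Def. 6.13] ("It
follows from the definition that we always have `M = λ bᵏ`"; here under the standing assumption
`k ≤ sT`, which provides admissible heights `d_i`): the rows are partitioned according to their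
entries on the selected `k` columns, `bᵏ` classes of `lam` rows each. -/
theorem IsOrderedOrthogonalArray.card_eq [NeZero b] {T k lam : ℕ} {A : κ → ι → Fin T → Fin b}
    (hA : IsOrderedOrthogonalArray b k lam A) (hk : k ≤ Fintype.card ι * T) :
    Fintype.card κ = lam * b ^ k := by
  classical
  obtain ⟨d, hd, hsum⟩ := exists_heights_of_le (ι := ι) hk
  let f : κ → ((i : ι) → Fin (d i) → Fin b) := fun n i j => A n i (Fin.castLE (hd i) j)
  have hfib : ∀ g : (i : ι) → Fin (d i) → Fin b, (univ.filter fun n => f n = g).card = lam := by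
    intro g
    let c : ι → Fin T → Fin b := fun i j => if h : (j : ℕ) < d i then g i ⟨j, h⟩ else 0
    rw [← hA d hd hsum c]
    congr 1
    ext n
    simp only [mem_filter, mem_univ, true_and]
    constructor
    · rintro hg i j hj
      have := congr_fun (congr_fun hg i) ⟨j, hj⟩
      simp only [f, c, dif_pos hj] at this ⊢
      exact this
    · intro hc
      funext i j
      have := hc i (Fin.castLE (hd i) j) (by simp)
      simp only [f, c, Fin.val_castLE, dif_pos j.2] at this ⊢
      exact this
  rw [← card_univ, card_eq_sum_card_fiberwise (f := f) (t := univ) fun n _ => mem_univ _,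
    sum_congr rfl fun g _ => hfib g, sum_const, card_univ, smul_eq_mul, Fintype.card_pi,
    mul_comm]
  simp only [Fintype.card_fun, Fintype.card_fin]
  rw [prod_pow_eq_pow_sum, hsum]

/-- **The first columns of the blocks of an ordered orthogonal array form an orthogonal array**:
if `A = (A_1 | ⋯ | A_s)` is an `OOA(M, s, b, T, k)` of index `lam` with `T ≥ 1`, the `M × s`
matrix of the first columns of `A_1, …, A_s` is an `OA(M, s, b, k)` of index `lam` (choose
`d_i = 1` on the `k` selected columns, `0` elsewhere). [cite: DickPillichshammer2010, Ex. 6.12]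
(the hint; Mullen–Schmid) — for `T = 1` this is the remark "an `OOA(M, s, b, 1, k)` is an
`OA(M, s, b, k)`" after [cite: DickPillichshammer2010, Def. 6.13]. -/
theorem IsOrderedOrthogonalArray.isOrthogonalArray_head {T k lam : ℕ}
    {A : κ → ι → Fin T → Fin b} (hA : IsOrderedOrthogonalArray b k lam A) (hT : 0 < T) :
    IsOrthogonalArray b k lam fun n i => A n i ⟨0, hT⟩ := by
  classical
  intro S hS c
  let d : ι → ℕ := fun i => if i ∈ S then 1 else 0
  have hd : ∀ i, d i ≤ T := fun i => by
    simp only [d]; split_ifs <;> omega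
  have hsum : ∑ i, d i = k := by
    simp only [d, sum_boole, filter_mem_eq_inter, univ_inter, hS, Nat.cast_id]
  rw [← hA d hd hsum fun i _ => c i]
  congr 1
  ext n
  simp only [mem_filter, mem_univ, true_and]
  constructor
  · intro h i j hj
    by_cases hi : i ∈ S
    · have hj0 : j = ⟨0, hT⟩ := by
        apply Fin.ext
        simp only [d, if_pos hi] at hj
        simp only
        omega
      rw [hj0]
      exact h i hi
    · simp [d, if_neg hi] at hj
  · intro h i hi
    exact h i ⟨0, hT⟩ (by simp [d, if_pos hi])

/-- **An `OOA(M, s, b, 1, k)` is the same thing as an `OA(M, s, b, k)`** (remark after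
[cite: DickPillichshammer2010, Def. 6.13]: "for `s ≥ k`, it is clear that an `OOA(M, s, b, 1, k)`
is an `OA(M, s, b, k)`"; both conditions are vacuous for `s < k`). -/
theorem isOrderedOrthogonalArray_iff_isOrthogonalArray {k lam : ℕ}
    (A : κ → ι → Fin 1 → Fin b) :
    IsOrderedOrthogonalArray b k lam A ↔ IsOrthogonalArray b k lam fun n i => A n i 0 := by
  classical
  refine ⟨fun hA => hA.isOrthogonalArray_head Nat.one_pos, fun hB => ?_⟩
  intro d hd hsum c
  let S : Finset ι := univ.filter fun i => d i = 1
  have hS : S.card = k := by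
    rw [← hsum]
    have : ∀ i, d i = if d i = 1 then 1 else 0 := fun i => by
      have := hd i
      split_ifs with h <;> omega
    rw [sum_congr rfl fun i _ => this i, sum_boole]
    simp [S]
  rw [← hB S hS fun i => c i 0]
  congr 1
  ext n
  simp only [mem_filter, mem_univ, true_and]
  constructor
  · intro h i hi
    have hi' : d i = 1 := by simpa [S] using hi
    exact h i 0 (by simp [hi'])
  · intro h i j hj
    have hi' : d i = 1 := by have := hd i; omega
    have hj0 : j = 0 := Subsingleton.elim _ _
    subst hj0
    exact h i (by simp [S, hi'])

/-- The columns `j < d_i` of the blocks, as a set of column labels `(i, j)`. [folklore] -/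
private theorem card_filter_snd_lt {T : ℕ} (d : ι → ℕ) (hd : ∀ i, d i ≤ T) [DecidableEq ι] :
    (univ.filter fun p : ι × Fin T => (p.2 : ℕ) < d p.1).card = ∑ i, d i := by
  rw [card_filter, Fintype.sum_prod_type]
  refine sum_congr rfl fun i _ => ?_
  rw [← card_filter]
  have : (univ.filter fun j : Fin T => (j : ℕ) < d i) =
      univ.map (Fin.castLEEmb (hd i)) := by
    ext j
    simp only [mem_filter, mem_univ, true_and, mem_map, Fin.castLEEmb_apply]
    constructor
    · intro hj; exact ⟨⟨j, hj⟩, Fin.ext rfl⟩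
    · rintro ⟨j', rfl⟩; simp
  rw [this, card_map, card_univ, Fintype.card_fin]

/-- **An orthogonal array `OA(M, sT, b, k)` with columns labelled `(i, j)` is an ordered
orthogonal array `OOA(M, s, b, T, k)` of the same index** (the selected columns
`(i, j), j ≤ d_i`, are `k` distinct columns). [cite: DickPillichshammer2010, Ex. 6.11] (the hint,
for `T = k - 1`; Mullen–Schmid). -/
theorem IsOrthogonalArray.isOrderedOrthogonalArray_curry {T k lam : ℕ}
    {B : κ → ι × Fin T → Fin b} (hB : IsOrthogonalArray b k lam B) :
    IsOrderedOrthogonalArray b k lam fun n i j => B n (i, j) := by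
  classical
  intro d hd hsum c
  let S : Finset (ι × Fin T) := univ.filter fun p => (p.2 : ℕ) < d p.1
  have hS : S.card = k := by rw [← hsum]; exact card_filter_snd_lt d hd
  rw [← hB S hS fun p => c p.1 p.2]
  congr 1
  ext n
  simp only [mem_filter, mem_univ, true_and]
  constructor
  · rintro h ⟨i, j⟩ hp
    exact h i j (by simpa [S] using hp)
  · intro h i j hj
    exact h (i, j) (by simpa [S] using hj)

end Arrays

/-! ### Digit strings as points of `[0,1)` -/

section DigitString

variable {L : ℕ}

/-- `prefixIndex L w = Σ_i w_{L-1-i} bⁱ`. [folklore] -/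
private theorem val_prefixIndex (w : Fin L → Fin b) :
    ((prefixIndex L w : Fin (b ^ L)) : ℕ) = ∑ i : Fin L, (w (Fin.rev i) : ℕ) * b ^ (i : ℕ) := by
  show ((finFunctionFinEquiv (w ∘ Fin.rev) : Fin (b ^ L)) : ℕ) = _
  rw [finFunctionFinEquiv_apply]
  rfl

/-- Digit extraction from `prefixIndex`: `⌊prefixIndex L w / bⁱ⌋ mod b = w_{L-1-i}`. [folklore] -/
private theorem prefixIndex_div_pow_mod (w : Fin L → Fin b) (i : Fin L) :
    ((prefixIndex L w : Fin (b ^ L)) : ℕ) / b ^ (i : ℕ) % b = (w (Fin.rev i) : ℕ) := by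
  have h := finFunctionFinEquiv_symm_apply_val (finFunctionFinEquiv (w ∘ Fin.rev)) i
  rw [Equiv.symm_apply_apply] at h
  exact h.symm

variable (b) in
/-- The point `0.w₀w₁…w_{L-1}` (base `b`) `= Σ_{j<L} w_j b^{-(j+1)} = (Σ_j w_j b^{L-1-j}) / b^L`
of `[0,1)` with the finite digit string `w`. [cite: DickPillichshammer2010, Thm. 6.15] (the points
`x_{n,i} = Σ_r a_{n,r} b^{-r}` of the proof) -/
noncomputable def ofDigitString (w : Fin L → Fin b) : ℝ :=
  ((prefixIndex L w : Fin (b ^ L)) : ℕ) / (b : ℝ) ^ L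

/-- `0 ≤ 0.w₀…w_{L-1}`. [folklore] (the points `x_n ∈ [0,1)ˢ` of the proof of
[cite: DickPillichshammer2010, Thm. 6.15]) -/
theorem ofDigitString_nonneg (w : Fin L → Fin b) : 0 ≤ ofDigitString b w :=
  div_nonneg (Nat.cast_nonneg _) (pow_nonneg (Nat.cast_nonneg _) _)

/-- `0.w₀…w_{L-1} < 1`. [folklore] (the points `x_n ∈ [0,1)ˢ` of the proof of
[cite: DickPillichshammer2010, Thm. 6.15]) -/
theorem ofDigitString_lt_one [NeZero b] (w : Fin L → Fin b) : ofDigitString b w < 1 := by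
  have hb : (0 : ℝ) < (b : ℝ) ^ L := pow_pos (Nat.cast_pos.2 (Nat.pos_of_ne_zero (NeZero.ne b))) _
  rw [ofDigitString, div_lt_one hb]
  exact_mod_cast (prefixIndex L w).2

/-- `0.w₀…w_{L-1} ∈ [0,1)`. [folklore] (the points `x_n ∈ [0,1)ˢ` of the proof of
[cite: DickPillichshammer2010, Thm. 6.15]) -/
theorem ofDigitString_mem_Ico [NeZero b] (w : Fin L → Fin b) :
    ofDigitString b w ∈ Set.Ico (0 : ℝ) 1 :=
  ⟨ofDigitString_nonneg w, ofDigitString_lt_one w⟩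

/-- `0.w₀…w_{L-1} = Σ_{j<L} w_j b^{-(j+1)}` — the defining formula
`x_{n,i} = Σ_r a^{(i)}_{n,r} b^{-r}` of the points in the proof of
[cite: DickPillichshammer2010, Thm. 6.15]. [folklore] -/
theorem ofDigitString_eq_sum [NeZero b] (w : Fin L → Fin b) :
    ofDigitString b w = ∑ j : Fin L, (w j : ℝ) / (b : ℝ) ^ ((j : ℕ) + 1) := by
  have hb0 : (b : ℝ) ≠ 0 := Nat.cast_ne_zero.2 (NeZero.ne b)
  rw [ofDigitString, val_prefixIndex, ← Equiv.sum_comp Fin.revPerm]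
  push_cast
  rw [sum_div]
  refine sum_congr rfl fun j _ => ?_
  simp only [Fin.revPerm_apply, Fin.rev_rev, Fin.val_rev]
  have h2 : (b : ℝ) ^ L = (b : ℝ) ^ ((j : ℕ) + 1) * (b : ℝ) ^ (L - ((j : ℕ) + 1)) := by
    rw [← pow_add]; congr 1; omega
  rw [h2]
  field_simp

/-- **The digits of `0.w₀…w_{L-1}`** are `w₀, …, w_{L-1}, 0, 0, …`. [folklore] (the `b`-adic
expansion used in the proof of [cite: DickPillichshammer2010, Thm. 6.15]) -/
theorem digits_ofDigitString [NeZero b] (w : Fin L → Fin b) (j : ℕ) :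
    Real.digits (ofDigitString b w) b j = if h : j < L then w ⟨j, h⟩ else 0 := by
  have hb0 : (b : ℝ) ≠ 0 := Nat.cast_ne_zero.2 (NeZero.ne b)
  set X : ℕ := ((prefixIndex L w : Fin (b ^ L)) : ℕ) with hX
  show Fin.ofNat b ⌊ofDigitString b w * (b : ℝ) ^ (j + 1)⌋₊ = _
  apply Fin.ext
  rw [Fin.val_ofNat]
  split_ifs with hj
  · have h1 : ofDigitString b w * (b : ℝ) ^ (j + 1) = (X : ℝ) / ((b ^ (L - 1 - j) : ℕ) : ℝ) := by
      have h2 : (b : ℝ) ^ L = (b : ℝ) ^ (L - 1 - j) * (b : ℝ) ^ (j + 1) := by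
        rw [← pow_add]; congr 1; omega
      rw [ofDigitString, ← hX, h2]
      push_cast
      field_simp
    rw [h1, Nat.floor_div_eq_div]
    have h3 := prefixIndex_div_pow_mod w ⟨L - 1 - j, by omega⟩
    rw [← hX] at h3
    simp only at h3
    rw [h3]
    congr 2
    ext
    simp only [Fin.val_rev]
    omega
  · push Not at hj
    have h1 : ofDigitString b w * (b : ℝ) ^ (j + 1) = ((X * b ^ (j + 1 - L) : ℕ) : ℝ) := by
      have h2 : (b : ℝ) ^ (j + 1) = (b : ℝ) ^ L * (b : ℝ) ^ (j + 1 - L) := by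
        rw [← pow_add]; congr 1; omega
      rw [ofDigitString, ← hX, h2]
      push_cast
      field_simp
    rw [h1, Nat.floor_natCast, Fin.val_zero]
    exact Nat.mod_eq_zero_of_dvd (Dvd.dvd.mul_left (dvd_pow_self b (by omega)) X)

/-- The first `d ≤ L` digits of `0.w₀…w_{L-1}` are `w₀, …, w_{d-1}`. [folklore] (proof of
[cite: DickPillichshammer2010, Thm. 6.15]: "`c_{i,1}, …, c_{i,d_i}` are the first `d_i` digits of
the `b`-adic representation of `x_{n,i}`") -/
theorem digitsPrefix_digits_ofDigitString [NeZero b] (w : Fin L → Fin b) {d : ℕ} (hd : d ≤ L) :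
    digitsPrefix b d (Real.digits (ofDigitString b w) b) = fun j => w (Fin.castLE hd j) := by
  funext j
  show Real.digits (ofDigitString b w) b j = _
  rw [digits_ofDigitString, dif_pos (lt_of_lt_of_le j.2 hd)]
  rfl

end DigitString

/-! ### Nets and ordered orthogonal arrays -/

section Nets

variable [Fintype ι] [Fintype κ]

/-- A digit cylinder condition is a condition on the first digits. [folklore] -/
private theorem digitsPrefix_eq_iff {d : ℕ} (ξ : ℕ → Fin b) (a : Fin d → Fin b) :
    digitsPrefix b d ξ = a ↔ ∀ j : Fin d, ξ j = a j :=
  funext_iff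

/-- **Nets give ordered orthogonal arrays** (the "only if" half of
[cite: DickPillichshammer2010, Thm. 6.15], for any heights `T`): if `x_0, …, x_{b^{t+k}-1}` form
a `(t, t+k, s)`-net in base `b`, the `b^{t+k} × sT` matrix `a^{(i)}_{n,r} = x_{n,i,r}` (the `r`-th
`b`-adic digit of the `i`-th coordinate of `x_n`, `1 ≤ r ≤ T`) is an ordered orthogonal array
`OOA(b^{t+k}, s, b, T, k)` of index `bᵗ` — a `k`-tuple of prescribed leading digits is an
elementary interval of volume `b^{-k}`. -/
theorem IsTMSNet.isOrderedOrthogonalArray_digits [NeZero b] {t k : ℕ} {P : κ → ι → ℝ}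
    (h : IsTMSNet b t (t + k) P) (T : ℕ) :
    IsOrderedOrthogonalArray b k (b ^ t) fun n i (j : Fin T) => Real.digits (P n i) b j := by
  classical
  have hD := h.isDigitNetPi h.mem_unitCubeIco
  intro d hd hsum c
  have hsum' : ∑ i, d i = t + k - t := by rw [hsum]; omega
  rw [← hD.2.2 d hsum' fun i j => c i (Fin.castLE (hd i) j)]
  congr 1
  ext n
  simp only [mem_filter, mem_univ, true_and]
  simp only [digitsPrefix_eq_iff]
  constructor
  · intro hn i j
    exact hn i (Fin.castLE (hd i) j) (by simp)
  · intro hn i j hj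
    exact hn i ⟨j, hj⟩

/-- **Ordered orthogonal arrays of full height give nets** (the mechanism of the "if" half of
[cite: DickPillichshammer2010, Thm. 6.15]): if the `M × sk` matrix `E` is an
`OOA(M, s, b, k, k)` of index `bᵗ` (`s ≥ 1`), the `M` points `x_n` whose `i`-th coordinate has
`b`-adic digits the `n`-th row of the block `E_i` (and zeros afterwards) form a `(t, t+k, s)`-net in
base `b`: the elementary interval `∏_i [c_i b^{-d_i}, (c_i+1) b^{-d_i})`, `Σ d_i = k`, contains
`x_n` iff the first `d_i` digits of `x_{n,i}` are those of `c_i`, for all `i`. -/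
theorem IsOrderedOrthogonalArray.isTMSNet_ofDigitString [NeZero b] [Nonempty ι] {t k : ℕ}
    {E : κ → ι → Fin k → Fin b} (hE : IsOrderedOrthogonalArray b k (b ^ t) E) :
    IsTMSNet b t (t + k) fun n i => ofDigitString b (E n i) := by
  classical
  have hP : ∀ n, (fun i => ofDigitString b (E n i)) ∈ unitCubeIco ι :=
    fun n => Set.mem_univ_pi.2 fun i => ofDigitString_mem_Ico (E n i)
  rw [isTMSNet_iff_isDigitNetPi hP]
  refine ⟨Nat.le_add_right _ _, ?_, ?_⟩
  · rw [hE.card_eq (Nat.le_mul_of_pos_left k Fintype.card_pos), pow_add]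
  · intro d hsum a
    have hsum' : ∑ i, d i = k := by rw [hsum]; omega
    have hd : ∀ i, d i ≤ k := fun i =>
      (single_le_sum (fun i _ => Nat.zero_le (d i)) (mem_univ i)).trans hsum'.le
    let c : ι → Fin k → Fin b := fun i j => if h : (j : ℕ) < d i then a i ⟨j, h⟩ else 0
    rw [← hE d hd hsum' c]
    congr 1
    ext n
    simp only [mem_filter, mem_univ, true_and]
    simp only [digitsPrefix_digits_ofDigitString (E n _) (hd _)]
    constructor
    · intro hn i j hj
      have := congr_fun (hn i) ⟨j, hj⟩
      simp only [c, dif_pos hj] at this ⊢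
      exact this
    · intro hn i
      funext j
      have := hn i (Fin.castLE (hd i) j) (by simp)
      simp only [c, Fin.val_castLE, dif_pos j.2] at this ⊢
      exact this

/-- **The book's trick** in the proof of [cite: DickPillichshammer2010, Thm. 6.15]
(`x_{n,i} = Σ_{r=1}^{k-1} a^{(i)}_{n,r} b^{-r} + a^{(h(i))}_{n,1} b^{-k}` with `h(i) ≠ i`), as a
statement about arrays: if `A = (A_1 | ⋯ | A_s)` is an `OOA(M, s, b, T, T+1)` of index `lam` with
`T ≥ 1`, and `h : ι → ι` has no fixed point, then appending to each block `A_i` the first column of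
`A_{h(i)}` gives an `OOA(M, s, b, T+1, T+1)` of index `lam`.  (The two cases of the printed proof:
if `d_i > 0` for at least two `i` then all `d_i ≤ T` and the condition is one of `A`; if only
`d_{i'} = T + 1 > 0`, the selected columns are the `T` columns of `A_{i'}` and the first column of
`A_{h(i')}`.) -/
theorem IsOrderedOrthogonalArray.snocColumn {T lam : ℕ} {A : κ → ι → Fin T → Fin b}
    (hA : IsOrderedOrthogonalArray b (T + 1) lam A) (hT : 0 < T) {h : ι → ι} (hh : ∀ i, h i ≠ i) :
    IsOrderedOrthogonalArray b (T + 1) lam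
      fun n i => (Fin.snoc (A n i) (A n (h i) ⟨0, hT⟩) : Fin (T + 1) → Fin b) := by
  classical
  intro d hd hsum c
  by_cases hcase : ∀ i, d i ≤ T
  · -- Case 1: all heights are at most `T`: a condition of `A` itself.
    rw [← hA d hcase hsum fun i j => c i j.castSucc]
    congr 1
    ext n
    simp only [mem_filter, mem_univ, true_and]
    constructor
    · intro hn i j hj
      have := hn i j.castSucc hj
      rwa [Fin.snoc_castSucc] at this
    · intro hn i j hj
      have hjT : (j : ℕ) < T := lt_of_lt_of_le hj (hcase i)
      have hj' : j = (⟨j, hjT⟩ : Fin T).castSucc := Fin.ext rfl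
      rw [hj', Fin.snoc_castSucc]
      exact hn i ⟨j, hjT⟩ hj
  · -- Case 2: one height is `T + 1`, all others vanish.
    push Not at hcase
    obtain ⟨i₀, hi₀⟩ := hcase
    have hdi₀ : d i₀ = T + 1 := le_antisymm (hd i₀) hi₀
    have hrest : ∀ i, i ≠ i₀ → d i = 0 := by
      have h1 := add_sum_erase univ d (mem_univ i₀)
      rw [hsum, hdi₀] at h1
      have h2 : ∑ i ∈ univ.erase i₀, d i = 0 := by omega
      intro i hi
      exact sum_eq_zero_iff.1 h2 i (mem_erase.2 ⟨hi, mem_univ i⟩)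
    let d' : ι → ℕ := fun i => (if i = i₀ then T else 0) + if i = h i₀ then 1 else 0
    have hd' : ∀ i, d' i ≤ T := fun i => by
      simp only [d']
      by_cases h1 : i = i₀
      · have h2 : i ≠ h i₀ := by rw [h1]; exact (hh i₀).symm
        simp [h1, (hh i₀).symm]
      · by_cases h2 : i = h i₀
        · simp [h2, hh i₀]; omega
        · simp [h1, h2]
    have hsum' : ∑ i, d' i = T + 1 := by
      simp only [d', sum_add_distrib, sum_ite_eq', mem_univ, if_true]
    let c' : ι → Fin T → Fin b := fun i j =>
      if i = i₀ then c i₀ j.castSucc else c i₀ (Fin.last T)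
    rw [← hA d' hd' hsum' c']
    congr 1
    ext n
    simp only [mem_filter, mem_univ, true_and]
    constructor
    · -- from the condition on block `i₀` (height `T + 1`) to the condition of `A`
      intro hn i j hj
      by_cases h1 : i = i₀
      · subst h1
        have := hn i j.castSucc (by show (j : ℕ) < d i; rw [hdi₀]; exact Nat.lt_succ_of_lt j.2)
        rw [Fin.snoc_castSucc] at this
        change A n i j = if i = i then c i j.castSucc else c i (Fin.last T)
        rwa [if_pos rfl]
      · by_cases h2 : i = h i₀
        · have hj0 : (j : ℕ) = 0 := by
            simp only [d', if_neg h1, if_pos h2] at hj; omega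
          have hjz : j = ⟨0, hT⟩ := Fin.ext hj0
          have := hn i₀ (Fin.last T) (by rw [hdi₀]; simp)
          simp only [Fin.snoc_last] at this
          simp only [c', if_neg h1]
          rw [hjz, ← this, h2]
        · simp [d', if_neg h1, if_neg h2] at hj
    · intro hn i j hj
      by_cases h1 : i = i₀
      · subst h1
        -- `j` ranges over all of `Fin (T + 1)`
        refine Fin.lastCases ?_ (fun j' => ?_) j
        · rw [Fin.snoc_last]
          have := hn (h i) ⟨0, hT⟩ (by simp [d', hh i])
          change A n (h i) ⟨0, hT⟩ = if h i = i then c i (Fin.castSucc ⟨0, hT⟩) else c i (Fin.last T)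
            at this
          rwa [if_neg (hh i)] at this
        · rw [Fin.snoc_castSucc]
          have := hn i j' (by simp [d', (hh i).symm])
          change A n i j' = if i = i then c i j'.castSucc else c i (Fin.last T) at this
          rwa [if_pos rfl] at this
      · rw [hrest i h1] at hj
        exact absurd hj (Nat.not_lt_zero _)

/-- **[cite: DickPillichshammer2010, Thm. 6.15]** (Mullen–Schmid; Lawrence), heights `T = k - 1`.
Let `s ≥ 2`, `T ≥ 1`, `t ≥ 0`.  There exists a `(t, t+T+1, s)`-net in base `b` if and only if
there exists an ordered orthogonal array `OOA(b^{t+T+1}, s, b, T, T+1)` of index `bᵗ`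
(rows indexed by `κ`: the array condition forces `|κ| = b^{t+T+1}`).
"Only if": truncate the digit expansions of the coordinates after `T` digits.  "If": the points
`x_{n,i} = Σ_{r=1}^{T} a^{(i)}_{n,r} b^{-r} + a^{(h(i))}_{n,1} b^{-(T+1)}` with any `h(i) ≠ i`. -/
theorem exists_isTMSNet_iff_exists_isOrderedOrthogonalArray [NeZero b] [Nontrivial ι] {T : ℕ}
    (hT : 1 ≤ T) (t : ℕ) :
    (∃ P : κ → ι → ℝ, IsTMSNet b t (t + T + 1) P) ↔
      ∃ A : κ → ι → Fin T → Fin b, IsOrderedOrthogonalArray b (T + 1) (b ^ t) A := by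
  constructor
  · rintro ⟨P, hP⟩
    exact ⟨_, hP.isOrderedOrthogonalArray_digits T⟩
  · rintro ⟨A, hA⟩
    -- a fixed-point free map `h : ι → ι` (`s ≥ 2`)
    choose h hh using fun i : ι => exists_ne i
    exact ⟨_, (hA.snocColumn hT hh).isTMSNet_ofDigitString⟩

/-- **[cite: DickPillichshammer2010, Thm. 6.15]**, verbatim parameters: let `s, k ≥ 2` and `t ≥ 0`
(base `b ≥ 1`).  There exists a `(t, t+k, s)`-net in base `b` if and only if there exists an
ordered orthogonal array `OOA(b^{t+k}, s, b, k-1, k)` of index `bᵗ`. -/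
theorem exists_isTMSNet_iff_exists_isOrderedOrthogonalArray' [NeZero b] [Nontrivial ι] {k : ℕ}
    (hk : 2 ≤ k) (t : ℕ) :
    (∃ P : κ → ι → ℝ, IsTMSNet b t (t + k) P) ↔
      ∃ A : κ → ι → Fin (k - 1) → Fin b, IsOrderedOrthogonalArray b k (b ^ t) A := by
  obtain ⟨T, rfl⟩ : ∃ T, k = T + 1 := ⟨k - 1, by omega⟩
  exact exists_isTMSNet_iff_exists_isOrderedOrthogonalArray (by omega) t

/-- **Nets and ordered orthogonal arrays of full height** (the form of
[cite: DickPillichshammer2010, Thm. 6.15] with heights `k` instead of `k - 1`, valid for all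
`s ≥ 1`, `k ≥ 0`): a `(t, t+k, s)`-net in base `b` exists iff an `OOA(b^{t+k}, s, b, k, k)` of
index `bᵗ` exists — the first `k` digits of the coordinates, resp. the points with these digits. -/
theorem exists_isTMSNet_iff_exists_isOrderedOrthogonalArray_self [NeZero b] [Nonempty ι]
    (t k : ℕ) :
    (∃ P : κ → ι → ℝ, IsTMSNet b t (t + k) P) ↔
      ∃ E : κ → ι → Fin k → Fin b, IsOrderedOrthogonalArray b k (b ^ t) E :=
  ⟨fun ⟨_, hP⟩ => ⟨_, hP.isOrderedOrthogonalArray_digits k⟩,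
    fun ⟨_, hE⟩ => ⟨_, hE.isTMSNet_ofDigitString⟩⟩

/-- **[cite: DickPillichshammer2010, Thm. 6.12]** (Niederreiter [176, Theorem 1] of the book's
bibliography): let `s ≥ 2` and `t ≥ 0` (base `b ≥ 1`).  There exists a `(t, t+2, s)`-net in base
`b` if and only if there exists an orthogonal array `OA(b^{t+2}, s, b, 2)` of index `bᵗ`. -/
theorem exists_isTMSNet_iff_exists_isOrthogonalArray [NeZero b] [Nontrivial ι] (t : ℕ) :
    (∃ P : κ → ι → ℝ, IsTMSNet b t (t + 2) P) ↔
      ∃ A : κ → ι → Fin b, IsOrthogonalArray b 2 (b ^ t) A := by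
  rw [exists_isTMSNet_iff_exists_isOrderedOrthogonalArray (T := 1) le_rfl t]
  constructor
  · rintro ⟨A, hA⟩
    exact ⟨_, (isOrderedOrthogonalArray_iff_isOrthogonalArray A).1 hA⟩
  · rintro ⟨B, hB⟩
    refine ⟨fun n i _ => B n i, (isOrderedOrthogonalArray_iff_isOrthogonalArray _).2 ?_⟩
    exact hB

/-- **[cite: DickPillichshammer2010, Ex. 6.12]** (Mullen–Schmid, [165, Corollary 9] of the
book's bibliography; printed for `b, k ≥ 2`, `s ≥ k`): the existence of a `(t, t+k, s)`-net in base
`b` implies the existence of an orthogonal array `OA(b^{t+k}, s, b, k)` of index `bᵗ` — the matrix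
of the first `b`-adic digits of the coordinates (the printed `s ≥ k` only serves to make the array
condition non-vacuous). -/
theorem IsTMSNet.isOrthogonalArray_digits_zero [NeZero b] {t k : ℕ} {P : κ → ι → ℝ}
    (h : IsTMSNet b t (t + k) P) :
    IsOrthogonalArray b k (b ^ t) fun n i => Real.digits (P n i) b 0 :=
  (h.isOrderedOrthogonalArray_digits 1).isOrthogonalArray_head Nat.one_pos

/-- **[cite: DickPillichshammer2010, Ex. 6.11]** (Mullen–Schmid, [165, Corollary 8] of the
book's bibliography): let `s, k ≥ 2`, `t ≥ 0`.  The existence of an orthogonal array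
`OA(b^{t+k}, s(k-1), b, k)` of index `bᵗ` (columns labelled `(i, j)`) implies the existence of a
`(t, t+k, s)`-net in base `b` — such an array is an `OOA(b^{t+k}, s, b, k-1, k)` of index `bᵗ`. -/
theorem IsOrthogonalArray.exists_isTMSNet [NeZero b] [Nontrivial ι] {t k : ℕ} (hk : 2 ≤ k)
    {B : κ → ι × Fin (k - 1) → Fin b} (hB : IsOrthogonalArray b k (b ^ t) B) :
    ∃ P : κ → ι → ℝ, IsTMSNet b t (t + k) P :=
  (exists_isTMSNet_iff_exists_isOrderedOrthogonalArray' hk t).2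
    ⟨_, hB.isOrderedOrthogonalArray_curry⟩

end Nets

end Literature.Analysis.Quadrature
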